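import Summits.NavierStokesRegularity.NavierStokesRegularity.Theorems.CircuitPump.Negative.LoadBearing

/-!
# `CircuitPump` (stmt-NavierStokesRegularity-1834): structure every witness must have

Negative-side support lemmas for the crux `PerpetualPump.CircuitPump`, companion of
`Negative/LoadBearing.lean` (same seat, cdisprove work file `Cruxes/CircuitPump/Disproof.lean` §(b)). Sorry-free.

* `no_free_mode`: a mode obeying the free decay `ẋ = -lam^{4n/5}x` on `(-∞,0)` with the Type-I bound vanishes —
  "a freely decaying mode grows backward"; every nonzero mode of a pump is nonlinearly forced.
* `steady_mode_trivial`: a time-independent Type-I mode is zero (kills steady inverse cascades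
  `X_n = A·lam^{-n/5}` and constant-flux cascades `A·lam^{-n/3}`).
* `dss_up`, `dss_down`, `nontrivial_propagates_up`: exact self-similarity propagates (non)vanishing through all
  scales — the support of a pump in `n` is bi-infinite; no finite truncation in scale is a witness.
* `scalar_coeff_iff`, `scalar_rhs`: for `m = 1`, symmetry + cyclic cancellation force
  `coeff = a·(none ↦ 0, e₁ ↦ 1, e₂ ↦ 1, e₃ ↦ -2)`, i.e. the one-mode circuit IS the signed
  Katz–Pavlović/Cheskidov dyadic model `Ẋ_n = -lam^{4n/5}X_n + 2a(lam^nX_nX_{n+1} - lam^{n-1}X_{n-1}²)` at the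
  Navier–Stokes-critical exponent α = 2/5 (one real parameter, scaling out up to sign).
-/

set_option linter.dupNamespace false

noncomputable section

open scoped BigOperators
open Real Set

namespace Summit.NavierStokesRegularity.NavierStokesRegularity.Theorems.CircuitPumpNegative

variable {m : ℕ}

/-! ## (b) Structure every witness must have -/

/-- **(b1) "A freely decaying mode grows backward."** If mode `(i,n)` obeys the FREE equation
`Ẋ = -lam^{4n/5} X` on `(-∞,0)` (e.g. it is never the output of a gate, or its inputs vanish) and is
Type-I bounded there, it vanishes identically on `(-∞,0)`. So every nonzero mode of a pump is nonlinearly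
forced. [folklore] -/
theorem no_free_mode {lam : ℝ} (hlam : 1 < lam) (x : ℝ → ℝ) (n : ℤ) (C : ℝ)
    (hode : ∀ t : ℝ, t < 0 → HasDerivAt x (-(lam ^ ((4 / 5 : ℝ) * n)) * x t) t)
    (hTI : ∀ t : ℝ, t < 0 → lam ^ ((3 / 5 : ℝ) * n) * |x t| ≤ C / Real.sqrt (-t)) :
    ∀ t : ℝ, t < 0 → x t = 0 := by
  have hpos : 0 < lam := by linarith
  obtain ⟨a, ha, hapos⟩ : ∃ a : ℝ, a = lam ^ ((4 / 5 : ℝ) * n) ∧ 0 < a :=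
    ⟨_, rfl, Real.rpow_pos_of_pos hpos _⟩
  obtain ⟨w, hw, hwpos⟩ : ∃ w : ℝ, w = lam ^ ((3 / 5 : ℝ) * n) ∧ 0 < w :=
    ⟨_, rfl, Real.rpow_pos_of_pos hpos _⟩
  rw [← ha] at hode
  rw [← hw] at hTI
  -- g(t) = e^{a t} x(t) has zero derivative on (-∞,0)
  have hg' : ∀ t : ℝ, t < 0 → HasDerivAt (fun s => Real.exp (a * s) * x s) 0 t := by
    intro t ht
    have h1 : HasDerivAt (fun s : ℝ => Real.exp (a * s)) (Real.exp (a * t) * (a * 1)) t :=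
      ((hasDerivAt_id t).const_mul a).exp
    exact (h1.mul (hode t ht)).congr_deriv (by ring)
  have hconst : ∀ t₁ t₂ : ℝ, t₁ < 0 → t₂ < 0 →
      Real.exp (a * t₁) * x t₁ = Real.exp (a * t₂) * x t₂ := by
    intro t₁ t₂ h₁ h₂
    have key := Convex.norm_image_sub_le_of_norm_hasDerivWithin_le
      (f := fun s => Real.exp (a * s) * x s) (f' := fun _ => (0 : ℝ))
      (s := Set.Iio (0 : ℝ)) (C := 0) (fun t ht => (hg' t ht).hasDerivWithinAt)
      (fun t _ => by simp) (convex_Iio 0) h₂ h₁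
    rw [zero_mul, norm_le_zero_iff, sub_eq_zero] at key
    exact key
  -- if x(t₀) ≠ 0 for some t₀ < 0, Type I fails far in the past
  intro t₀ ht₀
  by_contra hx
  obtain ⟨c, hc, hcne⟩ : ∃ c : ℝ, c = Real.exp (a * t₀) * x t₀ ∧ c ≠ 0 :=
    ⟨_, rfl, mul_ne_zero (Real.exp_pos _).ne' hx⟩
  have hxc : ∀ t : ℝ, t < 0 → x t = c * Real.exp (-(a * t)) := by
    intro t ht
    have h := hconst t t₀ ht ht₀
    rw [hc]
    calc x t = Real.exp (-(a * t)) * (Real.exp (a * t) * x t) := by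
            rw [← mul_assoc, ← Real.exp_add]; simp
      _ = Real.exp (a * t₀) * x t₀ * Real.exp (-(a * t)) := by rw [h]; ring
  -- choose T ≥ 1 with w |c| a T ≥ |C| + 1
  obtain ⟨T, hT1, hT2⟩ : ∃ T : ℝ, 1 ≤ T ∧ (|C| + 1) / (w * |c| * a) ≤ T :=
    ⟨max 1 ((|C| + 1) / (w * |c| * a)), le_max_left _ _, le_max_right _ _⟩
  have hcpos : 0 < |c| := abs_pos.2 hcne
  have hden : 0 < w * |c| * a := by positivity
  have hprod : |C| + 1 ≤ w * |c| * a * T := by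
    have := (div_le_iff₀ hden).1 hT2
    linarith
  have hbound := hTI (-T) (by linarith)
  rw [hxc (-T) (by linarith), neg_neg] at hbound
  have hexp : a * T ≤ Real.exp (a * T) := by
    have := Real.add_one_le_exp (a * T)
    linarith
  have hsqrt : 1 ≤ Real.sqrt T := by
    rw [show (1 : ℝ) = Real.sqrt 1 from Real.sqrt_one.symm]
    exact Real.sqrt_le_sqrt hT1
  have hsqpos : 0 < Real.sqrt T := by linarith
  have hlhs : w * |c * Real.exp (-(a * -T))| = w * |c| * Real.exp (a * T) := by
    rw [abs_mul, abs_of_pos (Real.exp_pos _)]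
    ring_nf
  rw [hlhs] at hbound
  have h1 : w * |c| * (a * T) ≤ w * |c| * Real.exp (a * T) :=
    mul_le_mul_of_nonneg_left hexp (by positivity)
  have h2 : C / Real.sqrt T ≤ |C| := by
    rw [div_le_iff₀ hsqpos]
    calc C ≤ |C| := le_abs_self C
      _ = |C| * 1 := (mul_one _).symm
      _ ≤ |C| * Real.sqrt T := mul_le_mul_of_nonneg_left hsqrt (abs_nonneg _)
  linarith

/-- **(b2) Steady modes are trivial**: a time-independent Type-I-bounded mode is zero (this is what kills
the bi-infinite steady inverse cascades `X_n = A·lam^{-n/5}` and the constant-flux Kolmogorov cascade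
`X_n = A·lam^{-n/3}`, both genuine steady solutions of the inviscid part). [folklore] -/
theorem steady_mode_trivial {lam : ℝ} (hlam : 1 < lam) (x : ℝ → ℝ) (n : ℤ) (C : ℝ)
    (hsteady : ∀ t t' : ℝ, t < 0 → t' < 0 → x t = x t')
    (hTI : ∀ t : ℝ, t < 0 → lam ^ ((3 / 5 : ℝ) * n) * |x t| ≤ C / Real.sqrt (-t)) :
    ∀ t : ℝ, t < 0 → x t = 0 := by
  have hpos : 0 < lam := by linarith
  set w : ℝ := lam ^ ((3 / 5 : ℝ) * n) with hw
  have hwpos : 0 < w := Real.rpow_pos_of_pos hpos _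
  intro t₀ ht₀
  by_contra hx
  have hxpos : 0 < |x t₀| := abs_pos.2 hx
  -- take T with √T > (|C|+1)/(w |x t₀|)
  set T : ℝ := max 1 (((|C| + 1) / (w * |x t₀|)) ^ 2) with hT
  have hT1 : 1 ≤ T := le_max_left _ _
  have hbound := hTI (-T) (by linarith)
  rw [hsteady (-T) t₀ (by linarith) ht₀, neg_neg] at hbound
  have hsq : (|C| + 1) / (w * |x t₀|) ≤ Real.sqrt T := by
    calc (|C| + 1) / (w * |x t₀|) = Real.sqrt (((|C| + 1) / (w * |x t₀|)) ^ 2) := by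
            rw [Real.sqrt_sq (by positivity)]
      _ ≤ Real.sqrt T := Real.sqrt_le_sqrt (le_max_right _ _)
  have hsqpos : 0 < Real.sqrt T := Real.sqrt_pos.2 (by linarith)
  have h1 : |C| + 1 ≤ w * |x t₀| * Real.sqrt T := by
    have := (div_le_iff₀ (by positivity : 0 < w * |x t₀|)).1 hsq
    linarith
  have h2 : C / Real.sqrt T * Real.sqrt T = C := div_mul_cancel₀ C hsqpos.ne'
  have h3 : w * |x t₀| * Real.sqrt T ≤ C := by
    have := mul_le_mul_of_nonneg_right hbound hsqpos.le
    rwa [h2] at this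
  linarith [le_abs_self C]

/-- **(b3) DSS upward**: the self-similarity law iterates to all multiples of the period. -/
theorem dss_up {lam : ℝ} (hlam : 1 < lam) {k : ℕ} {X : Fin m → ℤ → ℝ → ℝ} (hdss : IsDSS lam k X)
    (i : Fin m) (n : ℤ) (t : ℝ) (ht : t < 0) (j : ℕ) :
    X i (n + (j * k : ℕ)) (lam ^ (-((4 / 5 : ℝ) * (j * k : ℕ))) * t) =
      lam ^ (-((1 / 5 : ℝ) * (j * k : ℕ))) * X i n t := by
  have hpos : 0 < lam := by linarith
  induction j with
  | zero => simp
  | succ j ih =>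
    have hscale : 0 < lam ^ (-((4 / 5 : ℝ) * (j * k : ℕ))) := Real.rpow_pos_of_pos hpos _
    have ht' : lam ^ (-((4 / 5 : ℝ) * (j * k : ℕ))) * t < 0 := mul_neg_of_pos_of_neg hscale ht
    have step := hdss i (n + (j * k : ℕ)) _ ht'
    have e1 : (n + ((j * k : ℕ) : ℤ) + (k : ℤ)) = n + (((j + 1) * k : ℕ) : ℤ) := by push_cast; ring
    have e2 : lam ^ (-((4 / 5 : ℝ) * k)) * (lam ^ (-((4 / 5 : ℝ) * (j * k : ℕ))) * t) =
        lam ^ (-((4 / 5 : ℝ) * ((j + 1) * k : ℕ))) * t := by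
      rw [← mul_assoc, ← Real.rpow_add hpos]; congr 2; push_cast; ring
    have e3 : lam ^ (-((1 / 5 : ℝ) * k)) * lam ^ (-((1 / 5 : ℝ) * (j * k : ℕ))) =
        lam ^ (-((1 / 5 : ℝ) * ((j + 1) * k : ℕ))) := by
      rw [← Real.rpow_add hpos]; congr 1; push_cast; ring
    rw [e1, e2, ih] at step
    rw [step, ← mul_assoc, e3]

/-- **(b3') DSS downward**: `X_{i,n-k}(t) = lam^{k/5} X_{i,n}(lam^{-4k/5} t)`; in particular a mode that is
nonzero at time `t` forces the mode `k` scales BELOW to be nonzero at the later time `lam^{-4k/5}t`, and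
(`dss_up`) the modes above to be nonzero at earlier times: the support of a pump in `n` is bi-infinite —
no finite truncation in scale is a witness, and the pump is "fed from `n = -∞`". -/
theorem dss_down {lam : ℝ} (hlam : 1 < lam) {k : ℕ} {X : Fin m → ℤ → ℝ → ℝ} (hdss : IsDSS lam k X)
    (i : Fin m) (n : ℤ) (t : ℝ) (ht : t < 0) :
    X i (n - k) t = lam ^ ((1 / 5 : ℝ) * k) * X i n (lam ^ (-((4 / 5 : ℝ) * k)) * t) := by
  have hpos : 0 < lam := by linarith
  have := hdss i (n - k) t ht
  rw [sub_add_cancel] at this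
  rw [this, ← mul_assoc, ← Real.rpow_add hpos]
  have : (1 / 5 : ℝ) * k + -((1 / 5 : ℝ) * k) = 0 := by ring
  rw [this, Real.rpow_zero, one_mul]

/-- A nonzero mode forces nonzero modes at all scales `n + jk` above it (at earlier, rescaled times). -/
theorem nontrivial_propagates_up {lam : ℝ} (hlam : 1 < lam) {k : ℕ} {X : Fin m → ℤ → ℝ → ℝ}
    (hdss : IsDSS lam k X) {i : Fin m} {n : ℤ} {t : ℝ} (ht : t < 0) (hx : X i n t ≠ 0) (j : ℕ) :
    X i (n + (j * k : ℕ)) (lam ^ (-((4 / 5 : ℝ) * (j * k : ℕ))) * t) ≠ 0 := by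
  have hpos : 0 < lam := by linarith
  rw [dss_up hlam hdss i n t ht j]
  exact mul_ne_zero (Real.rpow_pos_of_pos hpos _).ne' hx

/-! ### (b4) The `m = 1` sub-case is the signed Katz–Pavlović / Cheskidov dyadic model -/

/-- The six permutations of `Fin 3`. [folklore] -/
theorem sum_perm_fin_three {M : Type*} [AddCommMonoid M] (g : Equiv.Perm (Fin 3) → M) :
    ∑ σ : Equiv.Perm (Fin 3), g σ =
      g 1 + g (Equiv.swap 0 1) + g (Equiv.swap 0 2) + g (Equiv.swap 1 2) +
        g (Equiv.swap 0 1 * Equiv.swap 1 2) + g (Equiv.swap 1 2 * Equiv.swap 0 1) := by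
  have h : (Finset.univ : Finset (Equiv.Perm (Fin 3))) =
      {1, Equiv.swap 0 1, Equiv.swap 0 2, Equiv.swap 1 2, Equiv.swap 0 1 * Equiv.swap 1 2,
        Equiv.swap 1 2 * Equiv.swap 0 1} := by decide
  rw [h]
  rw [Finset.sum_insert (by decide), Finset.sum_insert (by decide), Finset.sum_insert (by decide),
    Finset.sum_insert (by decide), Finset.sum_insert (by decide), Finset.sum_singleton]
  abel

/-- The scalar structure constants: `none ↦ 0`, `e₁, e₂ ↦ a`, `e₃ ↦ -2a`. -/
def scalarCoeff (a : ℝ) : Fin 1 → Fin 1 → Fin 1 → Option (Fin 3) → ℝ :=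
  fun _ _ _ μ => match μ with
    | none => 0
    | some 0 => a
    | some 1 => a
    | some 2 => -2 * a

/-- **(b4) Classification for `m = 1`**: symmetry + cyclic cancellation hold iff the constants are
`scalarCoeff a` for `a = coeff 0 0 0 e₁`. (One real parameter; `a = 0` is the linear chain, dead by
`no_free_mode`; `a ≠ 0` scales to `a = -1/2` by `X ↦ -X/(2a)`... up to the sign of `X`.) -/
theorem scalar_coeff_iff (coeff : Fin 1 → Fin 1 → Fin 1 → Option (Fin 3) → ℝ) :
    (IsSym coeff ∧ IsCyc coeff) ↔ coeff = scalarCoeff (coeff 0 0 0 (some 0)) := by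
  constructor
  · rintro ⟨hS, hC⟩
    have h01 : coeff 0 0 0 (some 0) = coeff 0 0 0 (some 1) := by
      simpa using hS 0 0 0 (some 0)
    have hnone : coeff 0 0 0 none = 0 := by
      have := hC (fun _ => 0) none
      rw [sum_perm_fin_three] at this
      simp at this
      linarith
    have hsum : coeff 0 0 0 (some 0) + coeff 0 0 0 (some 1) + coeff 0 0 0 (some 2) = 0 := by
      have := hC (fun _ => 0) (some 0)
      rw [sum_perm_fin_three] at this
      have e0 : (Equiv.symm (1 : Equiv.Perm (Fin 3))) = 1 := by decide
      have e1 : (Equiv.swap (0 : Fin 3) 1 * Equiv.swap 1 2).symm = Equiv.swap 1 2 * Equiv.swap 0 1 := by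
        decide
      have e2 : (Equiv.swap (1 : Fin 3) 2 * Equiv.swap 0 1).symm = Equiv.swap 0 1 * Equiv.swap 1 2 := by
        decide
      simp [Equiv.swap_apply_of_ne_of_ne, Equiv.swap_apply_left, Equiv.symm_swap, e0, e1, e2,
        Equiv.Perm.coe_one] at this
      linarith
    funext i₁ i₂ i₃ μ
    have hi₁ : i₁ = 0 := Subsingleton.elim _ _
    have hi₂ : i₂ = 0 := Subsingleton.elim _ _
    have hi₃ : i₃ = 0 := Subsingleton.elim _ _
    subst hi₁; subst hi₂; subst hi₃
    rcases μ with _ | j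
    · simpa [scalarCoeff] using hnone
    · fin_cases j
      · simp [scalarCoeff]
      · simp [scalarCoeff]; linarith
      · simp [scalarCoeff]; linarith
  · intro h
    set a := coeff 0 0 0 (some 0)
    rw [h]
    constructor
    · intro i₁ i₂ i₃ μ
      rcases μ with _ | j
      · rfl
      · fin_cases j <;> simp [scalarCoeff, Equiv.swap_apply_of_ne_of_ne]
    · intro v μ
      have hv : v = fun _ => 0 := funext fun _ => Subsingleton.elim _ _
      subst hv
      rw [sum_perm_fin_three]
      rcases μ with _ | j
      · simp [scalarCoeff]
      · have e0 : (Equiv.symm (1 : Equiv.Perm (Fin 3))) = 1 := by decide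
        have e1 : (Equiv.swap (0 : Fin 3) 1 * Equiv.swap 1 2).symm = Equiv.swap 1 2 * Equiv.swap 0 1 := by
          decide
        have e2 : (Equiv.swap (1 : Fin 3) 2 * Equiv.swap 0 1).symm = Equiv.swap 0 1 * Equiv.swap 1 2 := by
          decide
        fin_cases j <;>
          simp [scalarCoeff, Equiv.swap_apply_of_ne_of_ne, Equiv.swap_apply_left,
            Equiv.swap_apply_right, Equiv.symm_swap, e0, e1, e2, Equiv.Perm.coe_one] <;> ring

/-- **(b4') The scalar right-hand side** is the viscous KP/Cheskidov dyadic model at α = 2/5: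
`F n t = -lam^{4n/5} X_n + 2a (lam^n X_n X_{n+1} - lam^{n-1} X_{n-1}²)`. -/
theorem scalar_rhs (lam : ℝ) (a : ℝ) (X : Fin 1 → ℤ → ℝ → ℝ) (n : ℤ) (t : ℝ) :
    rhsF lam (scalarCoeff a) X 0 n t =
      -(lam ^ ((4 / 5 : ℝ) * n)) * X 0 n t +
        2 * a * (lam ^ (n : ℝ) * X 0 n t * X 0 (n + 1) t - lam ^ ((n : ℝ) - 1) * X 0 (n - 1) t ^ 2) := by
  simp only [rhsF, Fin.sum_univ_one, Fintype.sum_option, Fin.sum_univ_three]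
  simp [scalarCoeff]
  ring


end Summit.NavierStokesRegularity.NavierStokesRegularity.Theorems.CircuitPumpNegative
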